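import Summits.CriticalPhenomena.CardyFormulaZ2.Theorems.CardyIKTransportIKLinearTransportTransportDefs
import Summits.CriticalPhenomena.CardyFormulaZ2.Theorems.CardyIKTransportIKMixedBoxCrossingDefectStubBridgeOfLaw
import Summits.CriticalPhenomena.CardyFormulaZ2.Theorems.CardyIKTransportIKMixedBoxCrossingStubPolyDoubling
import Summits.CriticalPhenomena.CardyFormulaZ2.Theorems.CardyIKTransportIKLinearTransportStubPinnedSamplerTransfer
import Summits.CriticalPhenomena.CardyFormulaZ2.Theorems.CardyIKTransportIKLinearTransportStubPinnedSamplerUniform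

/-!
# Stub `stub_BoxResampler` (line `pinned-diagram-exchange`, crux stmt-CriticalPhenomena-5076) —
# part L: box marginals of `ν_S`, extensionality by box-local events, black-box samplers

Theorem-only support file (`--supports stmt-CriticalPhenomena-5076`, registered sub-goal
`boxResampler_boxMarginal`):

* `boxResampler_boxMarginal` — FINITE MARGINALS ARE THE FREE FIELD: for every box `Λ = [a, a+W) × [b, b+H)` and
  every measurable event `E` determined by the colours of the cells of `Λ` and the diagonal flags of the faces with
  lower-left cell in `Λ`, `ν_S(E) = (boxLaw S Λ ∘ toObs S⁻¹)(E)`, where `boxLaw S Λ` is the free corner-fugacity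
  field of the r4 line (`cornerGibbsMeasure tIK (facesIn S Λ) Λ white ⊗ coinMeasure ½`) and `toObs` reads black
  cells and anti faces. At the origin this is the landed `stub_bridgeLaw`; a general corner is reached by the
  horizontal/vertical re-anchoring lifts of the gauge (`exists_lift_hshift`, `nuMix_map_vshift`) on one side and
  the relabelling covariance of the free field (`boxLaw_map_rel`, `toObs_rel`) on the other;
* `lintegral_eq_of_determined` — the same for box-determined measurable functions;
* `measure_ext_boxLocal` — two finite measures on `Obs` agreeing on the measurable events determined by the
  windows `[-k, k]²`, `k ≥ k₀`, are equal (π-system);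
* `exists_sampler` — every probability law on `Obs` is the law of a measurable function of the fresh bits `β`
  (fibrewise resampler of the line with a constant statistic + the uniform level `ps_beta_uniform`).
-/

noncomputable section

namespace Summit.CriticalPhenomena.CardyFormulaZ2.Theorems.IKLinearTransport.PinnedDiagramExchange
namespace BoxResampler

open scoped Classical BigOperators ENNReal NNReal MeasureTheory ProbabilityTheory
open MeasureTheory Set
open Literature.Probability.LatticeModels Literature.Probability.Percolation
open Summit.CriticalPhenomena.CardyFormulaZ2.Cruxes.IKMixedBoxCrossing.DefectClosureExploration
  (boxLaw cellRect stub_bridgeLaw gaugeBox freeBox BoxData)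
open Summit.CriticalPhenomena.CardyFormulaZ2.Cruxes.IKMixedBoxCrossing.DefectClosureExploration.BridgeLawStub
  (site exists_site_eq measurable_gaugeBox measurable_freeBox)
open Summit.CriticalPhenomena.CardyFormulaZ2.Cruxes.IKMixedBoxCrossing.DefectClosureExploration.BridgeOfLawStub
  (toObs measurable_toObs boxLaw_map_rel toObs_rel rel measurable_rel ofBox site_mem_ofBox_fst site_mem_ofBox_snd
    gaugeBox_fst gaugeBox_snd)
open Summit.CriticalPhenomena.CardyFormulaZ2.Cruxes.IKMixedBoxCrossing.PairedMirrorExploration.StubPatternLocality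
  (shiftObs vshift_eq_shiftObs exists_lift_hshift)
open Summit.CriticalPhenomena.CardyFormulaZ2.Cruxes.IKMixedBoxCrossing.PairedMirrorExploration.PolyDoublingStub
  (determinedOn_mono)

/-! ## Extensionality by box-local events -/

/-- The sup-balls around the origin increase with the radius. [folklore] -/
theorem ballInf_zero_mono {k k' : ℕ} (h : k ≤ k') : ballInf 0 k ⊆ ballInf 0 k' := fun w hw => by
  simp only [ballInf, mem_setOf_eq, Pi.zero_apply, sub_zero] at hw ⊢
  exact ⟨hw.1.trans (by exact_mod_cast h), hw.2.trans (by exact_mod_cast h)⟩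

/-- Box-local measurable events form a π-system. [folklore] -/
theorem isPiSystem_boxLocal :
    IsPiSystem {D : Set Obs | MeasurableSet D ∧ ∃ k : ℕ, D ∈ determinedOn (ballInf 0 k)} := by
  rintro D ⟨hDm, k, hD⟩ D' ⟨hD'm, k', hD'⟩ -
  refine ⟨hDm.inter hD'm, max k k', fun x y hxy => ?_⟩
  have h1 := determinedOn_mono (ballInf_zero_mono (le_max_left k k')) hD x y hxy
  have h2 := determinedOn_mono (ballInf_zero_mono (le_max_right k k')) hD' x y hxy
  simp only [mem_inter_iff, h1, h2]

/-- The box-local measurable events generate the σ-algebra of `Obs`. [folklore] -/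
theorem generateFrom_boxLocal :
    (inferInstance : MeasurableSpace Obs) =
      MeasurableSpace.generateFrom {D : Set Obs | MeasurableSet D ∧ ∃ k : ℕ, D ∈ determinedOn (ballInf 0 k)} := by
  set C := {D : Set Obs | MeasurableSet D ∧ ∃ k : ℕ, D ∈ determinedOn (ballInf 0 k)} with hC
  refine le_antisymm ?_ (MeasurableSpace.generateFrom_le fun D hD => hD.1)
  have hcoord : ∀ (w : Site 2) (b : Bool),
      Measurable[MeasurableSpace.generateFrom C] (fun q : Obs => if b then w ∈ q.1 else w ∈ q.2) := by
    intro w b T _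
    refine MeasurableSpace.measurableSet_generateFrom ⟨?_, max (w 0).natAbs (w 1).natAbs, fun x y h => ?_⟩
    · have : Measurable fun q : Obs => if b then w ∈ q.1 else w ∈ q.2 := by
        cases b
        · exact (measurable_set_mem w).comp measurable_snd
        · exact (measurable_set_mem w).comp measurable_fst
      exact this trivial
    · have hw : w ∈ ballInf 0 (max (w 0).natAbs (w 1).natAbs) := by
        simp only [ballInf, mem_setOf_eq, Pi.zero_apply, sub_zero, Nat.cast_max, Int.natCast_natAbs]
        exact ⟨le_max_left _ _, le_max_right _ _⟩
      have hw' := h w hw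
      cases b <;> simp only [mem_preimage, Bool.false_eq_true, ↓reduceIte, hw'.1, hw'.2]
  have h1 : Measurable[MeasurableSpace.generateFrom C] (fun q : Obs => q.1) :=
    (@measurable_set_iff _ _ (MeasurableSpace.generateFrom C) _).2 fun w => by simpa using hcoord w true
  have h2 : Measurable[MeasurableSpace.generateFrom C] (fun q : Obs => q.2) :=
    (@measurable_set_iff _ _ (MeasurableSpace.generateFrom C) _).2 fun w => by simpa using hcoord w false
  have hid : Measurable[MeasurableSpace.generateFrom C] (id : Obs → Obs) := h1.prodMk h2
  rw [measurable_iff_comap_le, MeasurableSpace.comap_id] at hid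
  exact hid

/-- EXTENSIONALITY BY BOX-LOCAL EVENTS: two finite measures on `Obs` that agree on every measurable event
determined by the window `[-k, k]²`, for every `k ≥ k₀`, are equal. [folklore] -/
theorem measure_ext_boxLocal (μ ν : Measure Obs) [IsFiniteMeasure μ] (k₀ : ℕ)
    (h : ∀ k : ℕ, k₀ ≤ k → ∀ D : Set Obs, MeasurableSet D → D ∈ determinedOn (ballInf 0 k) → μ D = ν D) :
    μ = ν := by
  refine ext_of_generate_finite _ generateFrom_boxLocal isPiSystem_boxLocal ?_ ?_
  · rintro D ⟨hDm, k, hD⟩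
    exact h (max k₀ k) (le_max_left _ _) D hDm (determinedOn_mono (ballInf_zero_mono (le_max_right _ _)) hD)
  · exact h k₀ le_rfl univ MeasurableSet.univ fun _ _ _ => Iff.rfl

/-! ## Box marginals of `ν_S` are the free field -/

/-- Horizontal re-anchoring of the LAW of the observables: shifting by `m` columns maps `ν_S` to the law of the
pattern shifted along (landed lift `exists_lift_hshift`). [folklore] -/
theorem nuMix_map_hshift (S : Set ℤ) (m : ℤ) : (νmix S).map (shiftObs ![m, 0]) = νmix {x : ℤ | x - m ∈ S} := by
  obtain ⟨Φ, hΦ, hobs⟩ := exists_lift_hshift S m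
  have hms : Measurable (shiftObs ![m, 0]) := StripLaw.measurable_shiftObs _
  rw [νmix, νmix, Measure.map_map hms (CouplingToLimits.measurable_obs S),
    show shiftObs ![m, 0] ∘ obs S = obs {x : ℤ | x - m ∈ S} ∘ Φ from funext fun ω => (hobs ω).symm,
    ← Measure.map_map (CouplingToLimits.measurable_obs _) hΦ.measurable, hΦ.map_eq]

/-- Composition of shifts of observables. [folklore] -/
theorem shiftObs_shiftObs (s t : Site 2) (x : Obs) : shiftObs s (shiftObs t x) = shiftObs (t + s) x := by
  refine Prod.ext (Set.ext fun v => ?_) (Set.ext fun v => ?_) <;>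
    simp only [shiftObs, mem_preimage, sub_sub, add_comm t s]

/-- AT THE ORIGIN: the `ν_S`-mass of an event determined by the box `[0, W) × [0, H)` is its mass under the free
field of that box read through `toObs` (`stub_bridgeLaw` + box locality of the event). [folklore] -/
theorem boxMarginal_origin (S : Set ℤ) (W H : ℕ) {E : Set Obs} (hE : MeasurableSet E)
    (hdet : E ∈ determinedOn {v : Site 2 | 0 ≤ v 0 ∧ v 0 < W ∧ 0 ≤ v 1 ∧ v 1 < H}) :
    νmix S E = ((boxLaw S (cellRect 0 0 W H)).map (toObs S)) E := by
  have e1 : obs S ⁻¹' E = gaugeBox S W H ⁻¹' (ofBox S ⁻¹' E) := by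
    ext ω
    refine hdet _ _ fun v hv => ?_
    obtain ⟨q, rfl⟩ := exists_site_eq hv.1 hv.2.1 hv.2.2.1 hv.2.2.2
    rw [site_mem_ofBox_fst, site_mem_ofBox_snd, gaugeBox_fst, gaugeBox_snd]
    exact ⟨Iff.rfl, Iff.rfl⟩
  have e2 : toObs S ⁻¹' E = freeBox W H ⁻¹' (ofBox S ⁻¹' E) := by
    ext x
    refine hdet _ _ fun v hv => ?_
    obtain ⟨q, rfl⟩ := exists_site_eq hv.1 hv.2.1 hv.2.2.1 hv.2.2.2
    rw [site_mem_ofBox_fst, site_mem_ofBox_snd]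
    exact ⟨Iff.rfl, Iff.rfl⟩
  rw [νmix, Measure.map_apply (CouplingToLimits.measurable_obs S) hE, Measure.map_apply (measurable_toObs S) hE,
    e1, e2, ← Measure.map_apply (measurable_gaugeBox S W H) MeasurableSet.of_discrete, stub_bridgeLaw S W H,
    Measure.map_apply (measurable_freeBox W H) MeasurableSet.of_discrete]

/-- FINITE MARGINALS OF `ν_S` ARE THE FREE FIELD (registered sub-goal): for every box `[a, a+W) × [b, b+H)` and
every measurable event `E` determined by the colours of its cells and the diagonal flags of the faces with
lower-left cell in it, `ν_S(E)` is the mass of `E` under the free corner-fugacity field `boxLaw S (cellRect a b W H)`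
of the r4 line read through `toObs S` (black cells, anti faces). [folklore] -/
theorem boxResampler_boxMarginal :
    ∀ (S : Set ℤ) (a b : ℤ) (W H : ℕ) (E : Set Obs), MeasurableSet E →
      E ∈ determinedOn {v : Site 2 | a ≤ v 0 ∧ v 0 < a + W ∧ b ≤ v 1 ∧ v 1 < b + H} →
      νmix S E = ((boxLaw S (cellRect a b W H)).map (toObs S)) E := by
  intro S a b W H E hE hdet
  -- the event read `(a, b)` to the lower left, determined by the box at the origin
  set E₂ : Set Obs := {y | shiftObs ![a, b] y ∈ E} with hE₂
  have hms : ∀ t : Site 2, Measurable (shiftObs t) := fun t => StripLaw.measurable_shiftObs t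
  have hE₂m : MeasurableSet E₂ := (hms ![a, b]) hE
  have hdet₂ : E₂ ∈ determinedOn {v : Site 2 | 0 ≤ v 0 ∧ v 0 < W ∧ 0 ≤ v 1 ∧ v 1 < H} := by
    intro y y' hyy'
    refine hdet _ _ fun v hv => ?_
    have hv' : v - ![a, b] ∈ {v : Site 2 | 0 ≤ v 0 ∧ v 0 < W ∧ 0 ≤ v 1 ∧ v 1 < H} := by
      simp only [mem_setOf_eq, Pi.sub_apply, Matrix.cons_val_zero, Matrix.cons_val_one] at hv ⊢
      omega
    exact hyy' (v - ![a, b]) hv'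
  -- gauge side: re-anchor at `(a, b)`
  have hgauge : νmix S E = νmix {x : ℤ | x + a ∈ S} E₂ := by
    have hE' : E = shiftObs ![-a, -b] ⁻¹' E₂ := by
      ext x
      simp only [hE₂, mem_preimage, mem_setOf_eq, shiftObs_shiftObs]
      rw [show (![-a, -b] : Site 2) + ![a, b] = 0 by
        ext i; fin_cases i <;> simp]
      simp only [shiftObs, sub_zero, Set.preimage_id', Prod.mk.eta]
    have hcomp : shiftObs ![-a, -b] = shiftObs ![-a, 0] ∘ vshift (-b) := by
      funext x
      rw [Function.comp_apply, vshift_eq_shiftObs, shiftObs_shiftObs]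
      congr 1
      ext i; fin_cases i <;> simp
    rw [hE', ← Measure.map_apply (hms _) hE₂m, hcomp,
      ← Measure.map_map (hms _) (measurable_vshift _), nuMix_map_vshift, nuMix_map_hshift]
    simp only [sub_neg_eq_add]
  -- free side: relabel the free field of the box at the origin
  have hfree : ((boxLaw {x : ℤ | x + a ∈ S} (cellRect 0 0 W H)).map (toObs {x : ℤ | x + a ∈ S})) E₂ =
      ((boxLaw S (cellRect a b W H)).map (toObs S)) E := by
    have hobs : ∀ z, toObs S (rel ![a, b] z) = shiftObs ![a, b] (toObs {x : ℤ | x + a ∈ S} z) := fun z => by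
      simpa only [Matrix.cons_val_zero] using toObs_rel S ![a, b] z
    rw [Measure.map_apply (measurable_toObs _) hE₂m, Measure.map_apply (measurable_toObs _) hE, ← boxLaw_map_rel S a b W H,
      Measure.map_apply (measurable_rel _) (measurable_toObs S hE)]
    congr 1
    ext z
    simp only [hE₂, mem_preimage, mem_setOf_eq, hobs]
  rw [hgauge, boxMarginal_origin _ W H hE₂m hdet₂, hfree]

/-- The same identity for box-determined measurable FUNCTIONS (factor through the measurable restriction to the
box). [folklore] -/
theorem lintegral_eq_of_determined (S : Set ℤ) (a b : ℤ) (W H : ℕ) {Ψ : Obs → ℝ≥0∞} (hΨm : Measurable Ψ)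
    (hΨ : ∀ x y : Obs, (∀ v : Site 2, a ≤ v 0 ∧ v 0 < a + W ∧ b ≤ v 1 ∧ v 1 < b + H →
      (v ∈ x.1 ↔ v ∈ y.1) ∧ (v ∈ x.2 ↔ v ∈ y.2)) → Ψ x = Ψ y) :
    ∫⁻ x, Ψ x ∂(νmix S) = ∫⁻ x, Ψ x ∂((boxLaw S (cellRect a b W H)).map (toObs S)) := by
  set bx : Set (Site 2) := {v : Site 2 | a ≤ v 0 ∧ v 0 < a + W ∧ b ≤ v 1 ∧ v 1 < b + H} with hbx
  set r : Obs → Obs := fun x => ({v | v ∈ x.1 ∧ v ∈ bx}, {v | v ∈ x.2 ∧ v ∈ bx}) with hr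
  have hrm : Measurable r := by
    refine (measurable_set_iff.2 fun v => ?_).prodMk (measurable_set_iff.2 fun v => ?_)
    · exact ((measurable_set_mem v).comp measurable_fst).and measurable_const
    · exact ((measurable_set_mem v).comp measurable_snd).and measurable_const
  have hΨr : Ψ = Ψ ∘ r := funext fun x => hΨ x (r x) fun v hv => by
    simp only [hr, mem_setOf_eq, hbx, hv, and_true, and_self]
  have hmap : (νmix S).map r = ((boxLaw S (cellRect a b W H)).map (toObs S)).map r := by
    refine Measure.ext fun T hT => ?_
    rw [Measure.map_apply hrm hT, Measure.map_apply hrm hT]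
    refine boxResampler_boxMarginal S a b W H _ (hrm hT) fun x y hxy => ?_
    have : r x = r y := by
      refine Prod.ext (Set.ext fun v => ?_) (Set.ext fun v => ?_)
      · simp only [hr, mem_setOf_eq]
        exact ⟨fun h => ⟨(hxy v h.2).1.1 h.1, h.2⟩, fun h => ⟨(hxy v h.2).1.2 h.1, h.2⟩⟩
      · simp only [hr, mem_setOf_eq]
        exact ⟨fun h => ⟨(hxy v h.2).2.1 h.1, h.2⟩, fun h => ⟨(hxy v h.2).2.2 h.1, h.2⟩⟩
    simp only [mem_preimage, this]
  calc ∫⁻ x, Ψ x ∂(νmix S) = ∫⁻ x, (Ψ ∘ r) x ∂(νmix S) := by rw [← hΨr]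
    _ = ∫⁻ x, Ψ x ∂((νmix S).map r) := (lintegral_map hΨm hrm).symm
    _ = ∫⁻ x, Ψ x ∂(((boxLaw S (cellRect a b W H)).map (toObs S)).map r) := by rw [hmap]
    _ = ∫⁻ x, (Ψ ∘ r) x ∂((boxLaw S (cellRect a b W H)).map (toObs S)) := lintegral_map hΨm hrm
    _ = _ := by rw [← hΨr]

/-! ## Black-box samplers driven by the fresh bits -/

/-- Every probability law on `Obs` is the law of a measurable function of the fresh bits `β` (the fibrewise
resampler of the line with a constant statistic, driven by the uniform level `U 0` of `ps_beta_uniform`). [folklore] -/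
theorem exists_sampler (P : Measure Obs) [hP : IsProbabilityMeasure P] :
    ∃ s : Rnd → Obs, Measurable s ∧ β.map s = P := by
  haveI : IsProbabilityMeasure β := by
    rw [show β = sitePercolation (Site 2 × ℕ) half from rfl]; infer_instance
  obtain ⟨U, hUm, -, -, hunif⟩ := ps_beta_uniform
  set x₀ : Obs := (∅, ∅) with hx₀
  have hπ : (Measure.dirac x₀).map (fun _ : Obs => (x₀, (∅ : Set (Site 2 × Site 2)))) =
      P.map (fun _ : Obs => (x₀, (∅ : Set (Site 2 × Site 2)))) := by
    rw [Measure.map_const, Measure.map_const, measure_univ, measure_univ]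
  obtain ⟨G, hG, -, hlaw⟩ := ps_exists_fibrewise_resampler (fun _ => (x₀, (∅ : Set (Site 2 × Site 2))))
    measurable_const (Measure.dirac x₀) P inferInstance hP hπ (U 0) (hUm 0) (hunif 0)
  refine ⟨G x₀, hG.comp measurable_prodMk_left, ?_⟩
  rw [← hlaw, Measure.dirac_prod, Measure.map_map hG measurable_prodMk_left]
  rfl

end BoxResampler
end Summit.CriticalPhenomena.CardyFormulaZ2.Theorems.IKLinearTransport.PinnedDiagramExchange

end
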